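import Summits.ResolutionOfSingularities.ResolutionOfSingularities.Theorems.FrobeniusLadderFInjectiveMacaulayficationProp44TidyPieces
import Summits.ResolutionOfSingularities.ResolutionOfSingularities.Theorems.MarkedTransferCampaignW46ThreefoldsSigmaCurveStep
import Literature.AlgebraicGeometry.Resolution.CurveCentreNearPointGammaPrimeQuotient
import Literature.AlgebraicGeometry.Resolution.CurveCentreSigmaCoincide
import Literature.AlgebraicGeometry.Resolution.BlowupReducedDimension
import HarnessLib

/-!
# [CoP1] Prop. 4.4 (`CossartPiltant2008_prop44`, F-71): CURVE-STEP BOOKKEEPING (ρ2) — after blowing up a regular order-`μ` curve `Y`,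
# every curve of `Σ′` is the strict transform of a curve of `Σ` off `Y`, or THE curve `Γ′` over `Y`

[L1 W4.5a · crux `FInjectiveMacaulayfication` (stmt-ResolutionOfSingularities-15315); D-0154 (2) RES inputs cell, seat res-inputs-p-8b (gen 2,
«assembly»); the residual oracle ρ2 `curveStep_curves` of res-inputs-p-5a's REACH decomposition (`candidates/F71_REACH_DECOMPOSITION_SIGNATURE_p5a.lean`
a2aaba0190a2cf04 :160, frozen by the referee, R49/R51), PROVED modulo the oracle `hT2b'` = [CoP1] Lemma 4.3 (4) `Γ′` (`stub_T2b'_isRegular_gammaPrime`,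
SIGNATURES v3 l.212, binders verbatim — exactly as in `…Prop44SliceCurve.lean`, p620059). Fact-free, definition-free; nothing of the manuscript
under adjudication is used. AI-written; AI review is weaker than expert review.]

CONTENT ([CoP1] p. 10, «n(i+1) ≤ n(i)»; Lemma 4.3 (2) (4)). `X` regular locally Noetherian of dimension `≤ 3`, `J`, `μ ≥ 1`, `ord ≤ μ`, `V(J)` of
codimension `≥ 2`; `Y` a regular irreducible curve with `ord = μ` along it and `𝓘_Y` an rsop pair at each point; `π : X′ → X` the blowing up along
`Y`, `J′` the weak transform, `Σ′ = {ord J′ ≥ μ}`. For a maximal point `η′` of `Σ′` which is not closed: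
* OFF THE CENTRE (`π η′ ∉ Y`): `π` is an isomorphism over `X ∖ Y` (`IsBlowup.isIso_compl`), so specialisations and orders are read downstairs
  (`specializes_iff_of_not_mem_support`): `π η′` is a maximal point of `Σ` and `cl{η′} = cl(π⁻¹(cl{π η′} ∖ Y))` (the strict transform);
* OVER THE CENTRE (`π η′ ∈ Y`): `η′` is near; a near point over a CLOSED point of `Y` is closed (p613580), so `π η′` is the generic point of `Y`;
  by `hT2b'` the closure `Γ′ = cl{η′}` is regular (rsop pairs at its points: `exists_rsopPair_of_mem_curve`, p619773, with `codim η′ = 2` by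
  p620167), and any other such `η″` over `Y` equals `η′` (uniqueness of near points over a curve centre, p613580).

* `specializes_iff_of_not_mem_support`, `closure_eq_closure_preimage_of_not_mem`, `mem_maxPoints_of_not_mem` — the
  off-centre glue for an arbitrary centre;
* `curveStep_curves` — ρ2, binders of the frozen signature VERBATIM followed by the oracle `hT2b'`.

`CossartPiltant2008_prop44` is NOT proved; resolution in dimension `≥ 4` / positive characteristic is NOT proved.

References: V. Cossart, O. Piltant, J. Algebra 320 (2008), Lemma 4.3 (2) (4), Prop. 4.4 (proof, p. 10) [CossartPiltant2008]; U. Görtz, T. Wedhorn,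
*Algebraic Geometry I* (2020), Prop. 13.91 (3) [GortzWedhorn2020]; The Stacks Project, Tag 02OS [StacksProject].
-/

-- `Summit.<Summit>.<Sub>.Theorems` with `Sub = Summit` (single-conjunct summit, D-0017)
set_option linter.dupNamespace false

noncomputable section

open CategoryTheory CategoryTheory.Limits AlgebraicGeometry TopologicalSpace IsLocalRing
open Literature.AlgebraicGeometry.Resolution Scheme.IdealSheafData

namespace Summit.ResolutionOfSingularities.ResolutionOfSingularities.Theorems

namespace CP2008Prop44

universe u

/-! ## §0 Off the centre a blowing up is an isomorphism: specialisations, closures, maximal points -/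

/-- **Specialisation off the centre**: for `π y′ ∉ supp C`, `ζ′ ⤳ y′ ↔ π ζ′ ⤳ π y′` (`π` restricts to an isomorphism over `X ∖ supp C`,
and specialisation is computed inside these opens). [cite: GortzWedhorn2020, Prop. 13.91 (3)] [cite: StacksProject, Tag 02OS] -/
theorem specializes_iff_of_not_mem_support {X X' : Scheme.{u}} {π : X' ⟶ X} {C : X.IdealSheafData} (hπ : IsBlowup π C)
    {ζ' y' : X'} (hy : π y' ∉ (C.support : Set X)) : ζ' ⤳ y' ↔ π ζ' ⤳ π y' := by
  refine ⟨fun h => h.map π.continuous, fun h => ?_⟩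
  have hζ : π ζ' ∉ (C.support : Set X) := fun e => hy (h.mem_closed C.support.isClosed e)
  set W : X.Opens := ⟨(C.support : Set X)ᶜ, C.support.isClosed.isOpen_compl⟩ with hW
  haveI : IsIso (π ∣_ W) := hπ.isIso_compl
  have hmem : ∀ {z : X'}, π z ∉ (C.support : Set X) → z ∈ π ⁻¹ᵁ W := fun {z} hz => hz
  haveI hg : IsOpenImmersion ((π ⁻¹ᵁ W).ι ≫ π) := by rw [← morphismRestrict_ι]; infer_instance
  have key : ((π ⁻¹ᵁ W).ι ≫ π) ⟨ζ', hmem hζ⟩ ⤳ ((π ⁻¹ᵁ W).ι ≫ π) ⟨y', hmem hy⟩ := by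
    rw [Scheme.Hom.comp_apply, Scheme.Hom.comp_apply, Scheme.Opens.ι_apply, Scheme.Opens.ι_apply]; exact h
  have h2 := ((π ⁻¹ᵁ W).ι ≫ π).isOpenEmbedding.isInducing.specializes_iff.mp key
  have h3 := (π ⁻¹ᵁ W).ι.isOpenEmbedding.isInducing.specializes_iff.mpr h2
  rw [Scheme.Opens.ι_apply, Scheme.Opens.ι_apply] at h3
  exact h3

/-- **The closure of a point off the centre is the strict transform of the closure of its image**: for `π η′ ∉ supp C`,
`cl{η′} = cl(π⁻¹(cl{π η′} ∖ supp C))`. [cite: GortzWedhorn2020, Prop. 13.91 (3)] -/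
theorem closure_eq_closure_preimage_of_not_mem {X X' : Scheme.{u}} {π : X' ⟶ X} {C : X.IdealSheafData} (hπ : IsBlowup π C)
    {η' : X'} (hη : π η' ∉ (C.support : Set X)) :
    closure ({η'} : Set X') = closure (π ⁻¹' (closure {π η'} \ (C.support : Set X))) := by
  apply Set.Subset.antisymm
  · exact closure_mono (Set.singleton_subset_iff.mpr ⟨subset_closure rfl, hη⟩)
  · refine closure_minimal (fun z hz => ?_) isClosed_closure
    obtain ⟨hz1, hz2⟩ := hz
    have hsp : π η' ⤳ π z := specializes_iff_mem_closure.mpr hz1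
    exact specializes_iff_mem_closure.mp ((specializes_iff_of_not_mem_support hπ hz2).mpr hsp)

/-- **Maximal points off the centre descend**: if `η′` is a maximal point of `{ord J′ ≥ μ}` (`J′` the weak transform) with `π η′ ∉ supp C`,
then `π η′` is a maximal point of `{ord J ≥ μ}` (orders agree off the centre; a generisation downstairs lifts along the isomorphism).
[cite: GortzWedhorn2020, Prop. 13.91 (3)] -/
theorem mem_maxPoints_of_not_mem {X X' : Scheme.{u}} {π : X' ⟶ X} {C : X.IdealSheafData} (hπ : IsBlowup π C)
    (J : X.IdealSheafData) (μ : ℕ) {η' : X'} (hη : π η' ∉ (C.support : Set X))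
    (hmax : η' ∈ maxPoints {z : X' | (μ : ℕ∞) ≤ idealOrder (controlledTransform π C J μ) z}) :
    π η' ∈ maxPoints {z : X | (μ : ℕ∞) ≤ idealOrder J z} := by
  obtain ⟨hη'S, hη'max⟩ := mem_maxPoints_iff.mp hmax
  refine mem_maxPoints_iff.mpr ⟨?_, fun ζ hζ hsp => ?_⟩
  · show (μ : ℕ∞) ≤ idealOrder J (π η')
    rw [← hπ.idealOrder_controlledTransform_of_not_mem J μ hη]
    exact hη'S
  · have hζC : ζ ∉ (C.support : Set X) := fun h => hη (hsp.mem_closed C.support.isClosed h)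
    obtain ⟨ζ', hζ'⟩ := hπ.exists_preimage_of_not_mem hζC
    have hsp' : ζ' ⤳ η' := (specializes_iff_of_not_mem_support hπ hη).mpr (by rw [hζ']; exact hsp)
    have hζ'S : ζ' ∈ {z : X' | (μ : ℕ∞) ≤ idealOrder (controlledTransform π C J μ) z} := by
      show (μ : ℕ∞) ≤ idealOrder (controlledTransform π C J μ) ζ'
      rw [hπ.idealOrder_controlledTransform_of_not_mem J μ (by rw [hζ']; exact hζC), hζ']
      exact hζ
    rw [← hζ', hη'max ζ' hζ'S hsp']

/-! ## §1 ρ2: the curves of `Σ′` after blowing up a regular order-`μ` curve -/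

/-- **ρ2 — CURVE-STEP BOOKKEEPING ([CoP1] Lemma 4.3 (2), (4); Prop. 4.4 p. 10 «n(i+1) ≤ n(i)»), binders of the frozen signature
`curveStep_curves` (res-inputs-p-5a, a2aaba0190a2cf04 :160) VERBATIM, followed by the oracle `hT2b'` (= `stub_T2b'_isRegular_gammaPrime`,
SIGNATURES v3 l.212, verbatim); `hcodim` is not needed and carries an underscore.** `X` regular locally Noetherian of dimension `≤ 3`, `J`, `μ ≥ 1`, `ord ≤ μ`, `V(J)` of codimension `≥ 2`; `Y ⊆ Σ`
a regular irreducible curve with `ord = μ` along it and `𝓘_Y` an rsop pair at each of its points; `π` the blowing up along `Y`, `J′` the weak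
transform. Then for every maximal point `η′` of `Σ′ = {ord J′ ≥ μ}` that is not closed: EITHER `π η′ ∉ Y`, `π η′` is a maximal point of `Σ`
and `cl{η′} = cl(π⁻¹(cl{π η′} ∖ Y))`; OR `cl{π η′} = Y`, `cl{η′}` is regular with an rsop pair at each of its points, and it is the ONLY
non-closed maximal point of `Σ′` over `Y`. [cite: CossartPiltant2008, Lemma 4.3 (2) (4); Prop. 4.4 (proof, p. 10)] -/
theorem curveStep_curves {X X' : Scheme.{u}} [IsLocallyNoetherian X] [IsLocallyNoetherian X'] (hX : Scheme.IsRegular X)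
    (hX3 : topologicalKrullDim X ≤ 3) (J : X.IdealSheafData) {μ : ℕ} (hμ : 1 ≤ μ) (hle : ∀ z, idealOrder J z ≤ μ)
    (_hcodim : ∀ z ∈ J.support, 1 < Order.coheight z) {Y : Closeds X}
    (hYreg : Scheme.IsRegular (vanishingIdeal Y).subscheme) (hYirr : IsIrreducible (Y : Set X))
    (hYord : ∀ y ∈ (Y : Set X), idealOrder J y = μ)
    (hYcurve : ∀ y ∈ (Y : Set X), ∀ hr : IsRegularLocalRing (X.presheaf.stalk y),
      ∃ c : Fin 2 → X.presheaf.stalk y, @IsRsopPart _ _ _ 2 c ∧ Ideal.span (Set.range c) = stalkIdeal (vanishingIdeal Y) y)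
    {π : X' ⟶ X} (hπ : IsBlowup π (vanishingIdeal Y)) {η' : X'}
    (hη' : η' ∈ maxPoints {z : X' | (μ : ℕ∞) ≤ idealOrder (controlledTransform π (vanishingIdeal Y) J μ) z})
    (hη'cl : ¬ IsClosed ({η'} : Set X'))
    (hT2b' : ∀ ⦃X' X : Scheme.{u}⦄ [IsLocallyNoetherian X] [IsLocallyNoetherian X'] (_hX : Scheme.IsRegular X) ⦃π : X' ⟶ X⦄
      ⦃Y : Closeds X⦄ (_hYirr : IsIrreducible ((Y : Closeds X) : Set X))
      (_hreg : Scheme.IsRegular (vanishingIdeal Y).subscheme) (_hπ : IsBlowup π (vanishingIdeal Y))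
      ⦃J : X.IdealSheafData⦄ ⦃μ : ℕ⦄ (_hμ : 1 ≤ μ) (_hY : ∀ y ∈ (Y : Set X), idealOrder J y = μ)
      (_hJ : ∀ x, idealOrder J x ≤ μ) ⦃η' : X'⦄ (_hη' : closure {π η'} = (Y : Set X))
      (_hcodim : Order.coheight (π η') = 2) (_hnear : IsNear π (vanishingIdeal Y) J μ η'),
      Scheme.IsRegular (vanishingIdeal (⟨closure {η'}, isClosed_closure⟩ : Closeds X')).subscheme ∧
        (∀ z ∈ closure ({η'} : Set X'), IsNear π (vanishingIdeal Y) J μ z) ∧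
        π '' closure ({η'} : Set X') = (Y : Set X)) :
    (π η' ∉ (Y : Set X) ∧ π η' ∈ maxPoints {z : X | (μ : ℕ∞) ≤ idealOrder J z} ∧
        closure ({η'} : Set X') = closure (π ⁻¹' (closure {π η'} \ (Y : Set X)))) ∨
      (closure ({π η'} : Set X) = (Y : Set X) ∧
        Scheme.IsRegular (vanishingIdeal (⟨closure {η'}, isClosed_closure⟩ : Closeds X')).subscheme ∧
        (∀ y ∈ closure ({η'} : Set X'), ∀ hr : IsRegularLocalRing (X'.presheaf.stalk y),
          ∃ c : Fin 2 → X'.presheaf.stalk y, @IsRsopPart _ _ _ 2 c ∧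
            Ideal.span (Set.range c) = stalkIdeal (vanishingIdeal (⟨closure {η'}, isClosed_closure⟩ : Closeds X')) y) ∧
        ∀ η'' ∈ maxPoints {z : X' | (μ : ℕ∞) ≤ idealOrder (controlledTransform π (vanishingIdeal Y) J μ) z},
          ¬ IsClosed ({η''} : Set X') → π η'' ∈ (Y : Set X) → η'' = η') := by
  classical
  have hcoh3 : ∀ z : X, Order.coheight z ≤ 3 := (topologicalKrullDim_le_iff_forall_coheight_le X 3).mp hX3
  have hX3' : topologicalKrullDim X' ≤ 3 := hπ.topologicalKrullDim_le_of_isLocallyNoetherian hX3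
  have hcoh3' : ∀ z : X', Order.coheight z ≤ 3 := (topologicalKrullDim_le_iff_forall_coheight_le X' 3).mp hX3'
  have hD : ∀ y ∈ (Y : Set X), (μ : ℕ∞) ≤ idealOrder J y := fun y hy => (hYord y hy).ge
  have hX' : Scheme.IsRegular X' :=
    ((CampaignW46.IsPermissibleBlowupSeq.single Y π hYreg hD hπ).isLocallyNoetherian_and_isRegular inferInstance hX).2
  have hYsupp : ((vanishingIdeal Y).support : Set X) = (Y : Set X) := Scheme.IdealSheafData.coe_support_vanishingIdeal Y
  set J' := controlledTransform π (vanishingIdeal Y) J μ with hJ'def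
  by_cases hmem : π η' ∈ (Y : Set X)
  · /- OVER THE CENTRE -/
    right
    -- the generic point of `Y`, of codimension `2`
    set η : X := hYirr.genericPoint with hηdef
    have hYη : (Y : Set X) = closure {η} := (hYirr.closure_genericPoint Y.isClosed).symm
    have hηY : η ∈ (Y : Set X) := by rw [hYη]; exact subset_closure rfl
    haveI : IsRegularLocalRing (X.presheaf.stalk η) := hX η
    have hcoh : Order.coheight η = 2 := by
      obtain ⟨c, hcr, hcY⟩ := hYcurve η hηY (hX η)
      rw [stalkIdeal_vanishingIdeal_eq_maximalIdeal_of_closure_eq hYη] at hcY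
      have hq := hcr.ringKrullDim_quotient_add
      rw [hcY] at hq
      letI := Ideal.Quotient.field (maximalIdeal (X.presheaf.stalk η))
      rw [ringKrullDim_eq_zero_of_field, zero_add, ringKrullDim_stalk_eq_coheight] at hq
      have h2 : ((Order.coheight η : ℕ∞) : WithBot ℕ∞) = ((2 : ℕ∞) : WithBot ℕ∞) := hq.symm.trans (by rfl)
      exact WithBot.coe_injective h2
    -- near points over `Y`; a non-closed one lies over `η`
    have hnear_of : ∀ z : X', π z ∈ (Y : Set X) → (μ : ℕ∞) ≤ idealOrder J' z → IsNear π (vanishingIdeal Y) J μ z :=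
      fun z hzY hz => isNear_iff.mpr (le_antisymm (hπ.idealOrder_controlledTransform_le_of_mem hX hYreg hYord hzY) hz)
    have hover : ∀ z : X', π z ∈ (Y : Set X) → (μ : ℕ∞) ≤ idealOrder J' z → ¬ IsClosed ({z} : Set X') → π z = η := by
      intro z hzY hz hzcl
      by_contra hne
      obtain ⟨-, hcl⟩ := isClosed_singleton_of_mem_closure_of_ne hcoh3 hcoh (hYη ▸ hzY) hne
      haveI := hX (π z)
      obtain ⟨c, hcr, hcY⟩ := hYcurve (π z) hzY (hX (π z))
      exact hzcl (hπ.isClosed_singleton_of_isNear_curve hX hX' hYreg hμ hYord hcl hcr hcY (hnear_of z hzY hz))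
    have hη'S : (μ : ℕ∞) ≤ idealOrder J' η' := (mem_maxPoints_iff.mp hη').1
    have hη'η : π η' = η := hover η' hmem hη'S hη'cl
    have hnearη' : IsNear π (vanishingIdeal Y) J μ η' := hnear_of η' hmem hη'S
    have hclη' : closure {π η'} = (Y : Set X) := by rw [hη'η, hYη]
    have hcohπη' : Order.coheight (π η') = 2 := by rw [hη'η]; exact hcoh
    obtain ⟨hregΓ, -, -⟩ := hT2b' hX hYirr hYreg hπ hμ hYord hle hclη' hcohπη' hnearη'
    have hcohη' : Order.coheight η' = 2 := hπ.coheight_eq_two_of_isNear_curve_generic hX hYreg hμ hYord hclη' hcohπη' hnearη'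
    refine ⟨hclη', hregΓ, fun y hy hr => ?_, fun η'' hη'' hη''cl hη''Y => ?_⟩
    · exact exists_rsopPair_of_mem_curve hX' hcoh3' hregΓ rfl hcohη' hy
    · have hη''S : (μ : ℕ∞) ≤ idealOrder J' η'' := (mem_maxPoints_iff.mp hη'').1
      have hη''η : π η'' = η := hover η'' hη''Y hη''S hη''cl
      have he : π η'' = π η' := hη''η.trans hη'η.symm
      haveI : IsRegularLocalRing (X.presheaf.stalk (π η')) := hX (π η')
      obtain ⟨c, hcr, hcY⟩ := hYcurve (π η') hmem (hX (π η'))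
      exact hπ.eq_of_isNear_of_isNear_curve hX hYreg hμ hYord hcr hcY hnearη' (hnear_of η'' hη''Y hη''S) he
  · /- OFF THE CENTRE -/
    left
    have hmem' : π η' ∉ ((vanishingIdeal Y).support : Set X) := by rwa [hYsupp]
    refine ⟨hmem, mem_maxPoints_of_not_mem hπ J μ hmem' hη', ?_⟩
    rw [← hYsupp]
    exact closure_eq_closure_preimage_of_not_mem hπ hmem'

end CP2008Prop44

end Summit.ResolutionOfSingularities.ResolutionOfSingularities.Theorems

end
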